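import Literature.NumberTheory.Sieve.BombieriFriedlanderIwaniecTheorem5Weights
import Mathlib.Analysis.Calculus.IteratedDeriv.Lemmas
import Mathlib.Analysis.Calculus.ContDiff.Deriv
import HarnessLib

/-!
# Pointwise bounds for iterated derivatives of products and dilations (smooth-weight toolkit)

Topic `Literature/NumberTheory/Sieve`.  To verify the smooth-weight hypothesis
`∂^ν g ≪_ν (c^{-ν₁}d^{-ν₂}n^{-ν₃}r^{-ν₄}s^{-ν₅})^{1-ε₀}` of the Deshouillers–Iwaniec type bound for
quintilinear sums of Kloosterman fractions (Drappeau 2017 Thm 2.1 / Assing–Blomer–Li 2021 Thm 2.3)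
for the weights of Drappeau 2017, §5.5 (`g = γ(q₀d)γ(q₀c)α(ξq₀cd) ×` cut-offs), one needs pointwise
bounds `‖f^{(i)}(x)‖ ≤ X u^i (i ≤ k)` that are stable under products and available for the tree's
plateau functions `BFI.bumpC M Y` and for dilations `x ↦ Q(a x)` of a fixed smooth compactly
supported `Q`.  This file provides exactly that (everything proved, no named fact):

* `KloostermanQuintilinear.DerivBound f x k X u` — `∀ i ≤ k, ‖f^{(i)}(x)‖ ≤ X u^i`;
* `DerivBound.mul` — Leibniz + binomial theorem: bounds `(X,u)`, `(Y,v)` give `(XY, u+v)` for `fg`;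
* `DerivBound.of_eventuallyEq_zero`, `DerivBound.mono`, `DerivBound.norm_le`;
* `derivBound_bumpC` — `BFI.bumpC M Y` has bounds `(2 ∑_{i≤k} derivConst i, Y⁻¹)`;
* `derivBound_comp_mul` — `x ↦ Q(a x)` has bounds `(M, |a|)` when `‖Q^{(i)}‖ ≤ M` (`i ≤ k`);
* `exists_bound_iteratedDeriv_of_hasCompactSupport` — smooth compactly supported `Q` have bounded
  derivatives of every order (via a private copy of the induction
  `SmoothIdealCosetSums.hasCompactSupport_iteratedDeriv`, not imported to keep imports light).

## References

* S. Drappeau, Proc. London Math. Soc. (3) 114 (2017) 684–732, arXiv:1504.05549, Theorem 2.1,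
  §5.5. [cite: Drappeau2017, §5.5]
* E. Assing, V. Blomer, J. Li, Adv. Math. 393 (2021), arXiv:2005.13915, Theorem 2.3.
  [cite: AssingBlomerLi2020, Theorem 2.3]
-/

noncomputable section

open scoped ContDiff Topology
open Filter

namespace Literature.NumberTheory.Sieve

namespace KloostermanQuintilinear

/-- `DerivBound f x k X u`: the first `k` derivatives of `f` at `x` satisfy `‖f^{(i)}(x)‖ ≤ X u^i`.
[folklore] -/
def DerivBound (f : ℝ → ℂ) (x : ℝ) (k : ℕ) (X u : ℝ) : Prop :=
  ∀ i : ℕ, i ≤ k → ‖iteratedDeriv i f x‖ ≤ X * u ^ i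

/-- Extract the bound of order `i ≤ k`. [folklore] -/
theorem DerivBound.norm_le {f : ℝ → ℂ} {x : ℝ} {k : ℕ} {X u : ℝ} (h : DerivBound f x k X u)
    {i : ℕ} (hi : i ≤ k) : ‖iteratedDeriv i f x‖ ≤ X * u ^ i :=
  h i hi

/-- Order zero: `‖f x‖ ≤ X`. [folklore] -/
theorem DerivBound.norm_self_le {f : ℝ → ℂ} {x : ℝ} {k : ℕ} {X u : ℝ} (h : DerivBound f x k X u) :
    ‖f x‖ ≤ X := by
  simpa using h 0 (Nat.zero_le _)

/-- Monotonicity in the order and the constants. [folklore] -/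
theorem DerivBound.mono {f : ℝ → ℂ} {x : ℝ} {k k' : ℕ} {X X' u u' : ℝ} (h : DerivBound f x k X u)
    (hk : k' ≤ k) (hX : X ≤ X') (hu : u ≤ u') (hX0 : 0 ≤ X) (hu0 : 0 ≤ u) :
    DerivBound f x k' X' u' := fun i hi =>
  (h i (hi.trans hk)).trans (mul_le_mul hX (pow_le_pow_left₀ hu0 hu i) (pow_nonneg hu0 _)
    (hX0.trans hX))

/-- A function vanishing near `x` has all derivatives `0` at `x`. [folklore] -/
theorem DerivBound.of_eventuallyEq_zero {f : ℝ → ℂ} {x : ℝ} (hf : f =ᶠ[𝓝 x] 0) (k : ℕ) {X u : ℝ}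
    (hX : 0 ≤ X) (hu : 0 ≤ u) : DerivBound f x k X u := by
  intro i _
  have h := (hf.iteratedDeriv i).eq_of_nhds
  have h0 : iteratedDeriv i (0 : ℝ → ℂ) x = 0 := iteratedDeriv_fun_const_zero
  rw [h, h0, norm_zero]
  positivity

/-- **Products** (Leibniz rule + binomial theorem): bounds `(X, u)` for `f` and `(Y, v)` for `g`
give `(XY, u + v)` for `fg`. [folklore] -/
theorem DerivBound.mul {f g : ℝ → ℂ} {x : ℝ} {k : ℕ} {X Y u v : ℝ} (hf : ContDiff ℝ ∞ f)
    (hg : ContDiff ℝ ∞ g) (h₁ : DerivBound f x k X u) (h₂ : DerivBound g x k Y v)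
    (hX : 0 ≤ X) (hu : 0 ≤ u) :
    DerivBound (fun t => f t * g t) x k (X * Y) (u + v) := by
  intro i hi
  have hfi : ContDiffAt ℝ i f x := (hf.of_le (by exact_mod_cast le_top)).contDiffAt
  have hgi : ContDiffAt ℝ i g x := (hg.of_le (by exact_mod_cast le_top)).contDiffAt
  rw [iteratedDeriv_fun_mul hfi hgi]
  calc ‖∑ j ∈ Finset.range (i + 1), (i.choose j : ℂ) * iteratedDeriv j f x * iteratedDeriv (i - j) g x‖
      ≤ ∑ j ∈ Finset.range (i + 1), (i.choose j : ℝ) * (X * u ^ j) * (Y * v ^ (i - j)) := by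
        refine (norm_sum_le _ _).trans (Finset.sum_le_sum fun j hj => ?_)
        rw [Finset.mem_range] at hj
        rw [norm_mul, norm_mul, Complex.norm_natCast]
        exact mul_le_mul (mul_le_mul_of_nonneg_left (h₁ j (by omega)) (Nat.cast_nonneg _))
          (h₂ (i - j) (by omega)) (norm_nonneg _) (by positivity)
    _ = X * Y * (u + v) ^ i := by
        rw [add_pow, Finset.mul_sum]
        refine Finset.sum_congr rfl fun j _ => ?_
        ring

/-! ### Smooth compactly supported functions have bounded derivatives -/

/-- Iterated derivatives of a compactly supported function are compactly supported (the same
four-line induction as `SmoothIdealCosetSums.hasCompactSupport_iteratedDeriv`, kept private here to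
avoid that file's heavy imports). [folklore] -/
private theorem hasCompactSupport_iteratedDeriv_of {Q : ℝ → ℂ} (hQ : HasCompactSupport Q) (n : ℕ) :
    HasCompactSupport (iteratedDeriv n Q) := by
  induction n with
  | zero => simpa using hQ
  | succ n ih => rw [iteratedDeriv_succ]; exact ih.deriv

/-- A smooth compactly supported `Q` has `‖Q^{(i)}‖ ≤ M` for all `i ≤ k`, some `M ≥ 0`.
[folklore] -/
theorem exists_bound_iteratedDeriv_of_hasCompactSupport {Q : ℝ → ℂ} (hQ : ContDiff ℝ ∞ Q)
    (hQs : HasCompactSupport Q) (k : ℕ) :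
    ∃ M : ℝ, 0 ≤ M ∧ ∀ i : ℕ, i ≤ k → ∀ t : ℝ, ‖iteratedDeriv i Q t‖ ≤ M := by
  have hb : ∀ i : ℕ, ∃ C : ℝ, ∀ t : ℝ, ‖iteratedDeriv i Q t‖ ≤ C := fun i =>
    (hQ.continuous_iteratedDeriv i (by exact_mod_cast le_top)).bounded_above_of_compact_support
      (hasCompactSupport_iteratedDeriv_of hQs i)
  choose C hC using hb
  refine ⟨∑ i ∈ Finset.range (k + 1), max (C i) 0, Finset.sum_nonneg fun _ _ => le_max_right _ _,
    fun i hi t => ?_⟩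
  calc ‖iteratedDeriv i Q t‖ ≤ max (C i) 0 := (hC i t).trans (le_max_left _ _)
    _ ≤ ∑ i ∈ Finset.range (k + 1), max (C i) 0 :=
        Finset.single_le_sum (f := fun i => max (C i) 0) (fun _ _ => le_max_right _ _)
          (Finset.mem_range.2 (by omega))

/-! ### Dilations -/

/-- **Dilations**: if `‖Q^{(i)}‖ ≤ M` for `i ≤ k`, then `x ↦ Q(a x)` has `DerivBound … k M |a|`.
[folklore] -/
theorem derivBound_comp_mul {Q : ℝ → ℂ} (hQ : ContDiff ℝ ∞ Q) {k : ℕ} {M : ℝ}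
    (hM : ∀ i : ℕ, i ≤ k → ∀ t : ℝ, ‖iteratedDeriv i Q t‖ ≤ M) (a x : ℝ) :
    DerivBound (fun t => Q (a * t)) x k M |a| := by
  intro i hi
  have h := iteratedDeriv_comp_const_smul (n := i) (hQ.of_le (by exact_mod_cast le_top)) a
  rw [h]
  simp only
  rw [norm_smul, norm_pow, Real.norm_eq_abs, mul_comm]
  exact mul_le_mul_of_nonneg_right (hM i hi _) (by positivity)

/-! ### The plateau functions `BFI.bumpC` -/

/-- `∑_{i ≤ k} derivConst i` dominates each `derivConst i`, `i ≤ k`, and is `≥ 1`. [folklore] -/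
def derivConstSum (k : ℕ) : ℝ := ∑ i ∈ Finset.range (k + 1), BFI.derivConst i

/-- `derivConst i ≤ derivConstSum k` for `i ≤ k`. [folklore] -/
theorem derivConst_le_derivConstSum {i k : ℕ} (hi : i ≤ k) : BFI.derivConst i ≤ derivConstSum k :=
  Finset.single_le_sum (f := BFI.derivConst)
    (fun j _ => zero_le_one.trans (BFI.one_le_derivConst j)) (Finset.mem_range.2 (by omega))

/-- `1 ≤ derivConstSum k`. [folklore] -/
theorem one_le_derivConstSum (k : ℕ) : 1 ≤ derivConstSum k :=
  (BFI.one_le_derivConst 0).trans (derivConst_le_derivConstSum (Nat.zero_le k))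

/-- **Plateau functions**: `BFI.bumpC M Y` (`Y > 0`, `M ≥ 0`) has
`‖∂^i bumpC‖ ≤ 2 (∑_{j≤k} derivConst j) · Y^{-i}` for `i ≤ k`. [folklore] -/
theorem derivBound_bumpC {M Y : ℝ} (hY : 0 < Y) (hM : 0 ≤ M) (k : ℕ) (t : ℝ) :
    DerivBound (BFI.bumpC M Y) t k (2 * derivConstSum k) Y⁻¹ := by
  intro i hi
  rcases Nat.eq_zero_or_pos i with h0 | hpos
  · subst h0
    rw [iteratedDeriv_zero, pow_zero, mul_one]
    exact (BFI.norm_bumpC_le_one hY hM t).trans (by linarith [one_le_derivConstSum k])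
  · calc ‖iteratedDeriv i (BFI.bumpC M Y) t‖ ≤ ‖iteratedDeriv i (BFI.bump M Y) t‖ :=
          BFI.norm_iteratedDeriv_bumpC_le i M Y t
      _ ≤ 2 * BFI.derivConst i * Y⁻¹ ^ i := BFI.norm_iteratedDeriv_bump_le hpos hY t
      _ ≤ 2 * derivConstSum k * Y⁻¹ ^ i := by
          have := derivConst_le_derivConstSum hi
          have h0 : 0 ≤ Y⁻¹ ^ i := by positivity
          nlinarith

end KloostermanQuintilinear

end Literature.NumberTheory.Sieve

end
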